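import Mathlib.Probability.Martingale.Basic
import HarnessLib

/-!
# Martingales survive an enlargement of the filtration by null sets

Topic `Probability/Process`; theorems only (no definition).  If `𝓕 ≤ 𝓖` are filtrations on a finite measure
space and every `𝓖 t`-measurable set is a.e. equal to an `𝓕 t`-measurable set (i.e. `𝓖` lies between `𝓕` and
its completion by null sets — the "usual augmentation" and everything in between), then every real
`𝓕`-martingale is a `𝓖`-martingale (`Martingale.of_le_of_ae_measurableSet`): conditional expectations are tested
on sets, and set integrals do not see null modifications of the set.  This is the form in which a process that is
adapted only up to a null set (a continuous modification of a stochastic integral, `LevyCharacterisationVecModification`)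
can be put on a common filtration with genuinely adapted ones without losing the martingale structure of the noise
(the modified process is adapted to `𝓕 t ⊔ σ(N)` for the exceptional null set `N`, a filtration of this kind).

## References

* D. Revuz, M. Yor, *Continuous Martingales and Brownian Motion* (3rd ed., 1999), Ch. I, §4 (usual conditions)
  and Ch. II, §2; J.-F. Le Gall, GTM 274 (2016), §3.1 (completed filtrations).
-/

set_option autoImplicit false

noncomputable section

open MeasureTheory Filter
open scoped ENNReal

namespace Literature.Probability.Process

variable {Ω ι : Type*} [Preorder ι] {m : MeasurableSpace Ω} {μ : Measure Ω} {𝓕 𝓖 : Filtration ι m}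
  {X : ι → Ω → ℝ}

/-- A real adapted integrable process whose set integrals over `𝓖 s`-sets are constant in time is a
`𝓖`-martingale (both inequalities of Mathlib's `submartingale_of_setIntegral_le`). [folklore] -/
private theorem martingale_of_setIntegral_eq [IsFiniteMeasure μ] (hadp : StronglyAdapted 𝓖 X)
    (hint : ∀ t, Integrable (X t) μ)
    (hX : ∀ s t : ι, s ≤ t → ∀ A : Set Ω, MeasurableSet[𝓖 s] A → ∫ ω in A, X s ω ∂μ = ∫ ω in A, X t ω ∂μ) :
    Martingale X 𝓖 μ := by
  have h1 : Submartingale X 𝓖 μ :=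
    submartingale_of_setIntegral_le hadp hint fun i j hij A hA ↦ (hX i j hij A hA).le
  have h2 : Submartingale (-X) 𝓖 μ := by
    refine submartingale_of_setIntegral_le hadp.neg (fun i ↦ (hint i).neg) fun i j hij A hA ↦ ?_
    simp only [Pi.neg_apply, integral_neg]
    exact neg_le_neg (hX i j hij A hA).ge
  have h3 : Supermartingale X 𝓖 μ := by simpa using h2.neg
  exact martingale_iff.2 ⟨h3, h1⟩

/-- **Enlarging the filtration by null sets preserves martingales.**  Let `𝓕 ≤ 𝓖` be filtrations on a finite
measure space such that every `𝓖 t`-measurable set is a.e. equal to some `𝓕 t`-measurable set.  Then a real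
`𝓕`-martingale is a `𝓖`-martingale. [cite: RevuzYor1999, Ch. I §4 (usual conditions; completion of a filtration)] -/
theorem Martingale.of_le_of_ae_measurableSet [IsFiniteMeasure μ] (hX : Martingale X 𝓕 μ) (hle : ∀ t, 𝓕 t ≤ 𝓖 t)
    (hnull : ∀ (t : ι) (A : Set Ω), MeasurableSet[𝓖 t] A → ∃ A' : Set Ω, MeasurableSet[𝓕 t] A' ∧ A =ᵐ[μ] A') :
    Martingale X 𝓖 μ := by
  refine martingale_of_setIntegral_eq (fun t ↦ (hX.stronglyMeasurable t).mono (hle t)) hX.integrable ?_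
  intro s t hst A hA
  obtain ⟨A', hA', hAA'⟩ := hnull s A hA
  rw [setIntegral_congr_set hAA', setIntegral_congr_set hAA']
  haveI : SigmaFiniteFiltration μ 𝓕 := inferInstance
  exact hX.setIntegral_eq hst hA'


/-! ### The enlargement of a filtration by one null set -/

/-- **The filtration `𝓕 t ⊔ σ({N})` for a null set `N`** (existence form, no definition): it contains `𝓕`, makes `N`
measurable at every time, and each of its sets is a.e. equal to an `𝓕 t`-measurable set (σ-algebra induction:
the generators are the `𝓕 t`-sets and `N =ᵐ ∅`, and the property is stable under complements and countable
unions) — so `Martingale.of_le_of_ae_measurableSet` applies to it.  This is the smallest «usual augmentation»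
making a given modification off `N` adapted. [cite: RevuzYor1999, Ch. I §4 (usual conditions; completion of a filtration)] -/
theorem exists_filtration_sup_null (𝓕 : Filtration ι m) (μ : Measure Ω) {N : Set Ω} (hNm : MeasurableSet N)
    (hN : μ N = 0) :
    ∃ 𝓖 : Filtration ι m, (∀ t, 𝓕 t ≤ 𝓖 t) ∧ (∀ t, MeasurableSet[𝓖 t] N) ∧
      ∀ (t : ι) (A : Set Ω), MeasurableSet[𝓖 t] A → ∃ A' : Set Ω, MeasurableSet[𝓕 t] A' ∧ A =ᵐ[μ] A' := by
  -- the enlarged σ-algebras, as generated σ-algebras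
  let G : ι → MeasurableSpace Ω := fun t ↦ MeasurableSpace.generateFrom ({s | MeasurableSet[𝓕 t] s} ∪ {N})
  have hFG : ∀ t, 𝓕 t ≤ G t := fun t s hs ↦
    MeasurableSpace.measurableSet_generateFrom (Set.mem_union_left _ hs)
  have hGN : ∀ t, MeasurableSet[G t] N := fun t ↦
    MeasurableSpace.measurableSet_generateFrom (Set.mem_union_right _ (Set.mem_singleton N))
  have hGle : ∀ t, G t ≤ m := fun t ↦
    MeasurableSpace.generateFrom_le fun s hs ↦ by
      rcases hs with hs | hs
      · exact 𝓕.le t s hs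
      · rw [Set.mem_singleton_iff.1 hs]; exact hNm
  have hGmono : ∀ s t, s ≤ t → G s ≤ G t := fun s t hst ↦
    MeasurableSpace.generateFrom_mono (Set.union_subset_union_left _ fun A hA ↦ 𝓕.mono hst A hA)
  refine ⟨⟨G, hGmono, hGle⟩, hFG, hGN, fun t A hA ↦ ?_⟩
  -- σ-algebra induction
  refine MeasurableSpace.generateFrom_induction ({s | MeasurableSet[𝓕 t] s} ∪ {N})
    (fun s _ ↦ ∃ A' : Set Ω, MeasurableSet[𝓕 t] A' ∧ s =ᵐ[μ] A') ?_ ?_ ?_ ?_ A hA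
  · intro s hs _
    rcases hs with hs | hs
    · exact ⟨s, hs, Filter.EventuallyEq.rfl⟩
    · refine ⟨∅, @MeasurableSet.empty _ (𝓕 t), ?_⟩
      rw [Set.mem_singleton_iff.1 hs]
      exact ae_eq_empty.2 hN
  · exact ⟨∅, @MeasurableSet.empty _ (𝓕 t), Filter.EventuallyEq.rfl⟩
  · rintro s - ⟨A', hA', hsA'⟩
    exact ⟨A'ᶜ, hA'.compl, hsA'.compl⟩
  · rintro s - hs
    choose A' hA' hsA' using hs
    exact ⟨⋃ n, A' n, MeasurableSet.iUnion hA', Filter.EventuallyEq.countable_iUnion hsA'⟩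

end Literature.Probability.Process

end
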